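import Mathlib
import Literature.AlgebraicGeometry.Resolution.TranscendenceDefect
import Literature.AlgebraicGeometry.Resolution.LocalBlowup
import Summits.ResolutionOfSingularities.ResolutionOfSingularities.Theorems.RadicialJungCleanModelsAbhyankarKnafKuhlmann
import Summits.ResolutionOfSingularities.ResolutionOfSingularities.Theorems.RadicialJungCleanModelsDimOfEmbRes
import HarnessLib

/-!
# Route `RadicialJung`, crux `CleanModels` (stmt-15917), line `Sketch` rev 35, stub 7 `stub_cleanModelsDimGEFour`: the crux in dimension
# `d = n + 1` (and for all `d ≥ 4`) from LOCAL MONOMIALIZATION along zero-dimensional valuations — the local input stated at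
# LOCAL-UNIFORMIZATION strength instead of embedded-resolution strength

Explicit-unit seat `decomp-res-hand-2` g3 (structural hand, stubs 5–7).  OURS; nothing here proves resolution in characteristic `p`.

State of stub 7 before this file (hand-2 g0/g2): `stub_cleanModelsDimGEFour` ⟸ ✓ `cleanModels_dim_of_embeddedResolution n` from THREE inputs
`hEmb_n` (embedded resolution of closed subsets of dimension `≤ n` of regular excellent schemes, CJS 2020 Cor. 1.5 shape — printed for `n ≤ 2`
only), `hND_{n+1}` (clean LU at non-discrete defect valuations, research) and `hZ_{n+1}` (two-model patching for `P_clean`, open for `n + 1 ≥ 4`);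
`hEmb_n` is consumed at exactly one joint (✓ `cleanLUConcl_of_isMin_pthPowerApprox_of_monomial_num_den`, hand-2 g2): to present a numerator and a
denominator of the best-approximation remainder `g₀ − f₀^p` as monomials in a regular system of parameters at the centre of the valuation on a
finitely generated refinement of the model.  THIS FILE replaces `hEmb_n` by that weaker, purely LOCAL statement, quantified as a hypothesis
`hMono_d` («local monomialization in dimension `d`»): for a finitely generated affine model `A ⊆ O` of `K/k`, regular of dimension `d` at the
centre of a valuation ring `O` all of whose centres above `A` are closed points, every finite set `Z ⊆ A` becomes, on some finitely generated
`A ⊆ A' ⊆ O` regular at the centre of `O`, a set of `𝒪`-monomials `z = v ∏ aᵢ^{μᵢ}` (`v` a unit, `(aᵢ)` a regular system of parameters of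
`(A')_{𝔪_O ∩ A'}`, `z ≠ 0`) — the conclusion shape of Knaf–Kuhlmann 2005 Thm. 1.1 with its monomiality clause
(`Literature.AlgebraicGeometry.Resolution.KnafKuhlmann2005_Thm11_monomialForm`), asked of the elements of the model only.

* `cleanLUConcl_of_isMin_pthPowerApprox_of_monomialization` — per valuation: best `p`-th-power approximation + monomialization of finite subsets
  of `A` along `O` ⟹ the conclusion of the line's dim-`d` local input (any `d`, any `O`; the proof of ✓ `cleanLUAbh_of_knafKuhlmann` with the
  named fact abstracted into a hypothesis).
* `hBest_dim_of_localMonomialization d`, `hAbh_dim_of_localMonomialization d` — the inputs `hBest_d`, `hAbh_d` of ✓ `cleanLUZeroDim_dim_of_cases`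
  from `hMono_d` (the Abhyankar one through Kuhlmann's generalized stability theorem ✓ `Kuhlmann2010Stability_holds` and
  ✓ `exists_isMin_pthPowerApprox_of_isDefectlessField`), every ground field.
* `cleanLUZeroDim_dim_of_localMonomialization d` — `CleanLUZeroDim_d` ⟸ `hMono_d ∧ hND_d` (arc class ✓, every `d`).
* `cleanModels_dim_of_localMonomialization n` — **`CleanModels` in dimension exactly `n + 1` ⟸ `hMono_{n+1} ∧ hND_{n+1} ∧ hZ_{n+1}`**
  (glue ✓ `cleanCharts_dim_of_cleanLUZeroDim_dim`, ✓ `cleanGlobalization_dim`, ✓ `cleanModelsAt_of_logCleanPrincipalizationAt`).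
* `cleanModelsDimGEFour_of_localMonomialization` — the registered stub `stub_cleanModelsDimGEFour` VERBATIM ⟸ the same three inputs asked in
  every dimension `d ≥ 4` (✓ `cleanModelsDimGEFour_of_localCases_of_cleanTwoModelPatching`, hand-2 g0).

Why this is the right currency (census): `hMono_d` is LOCAL UNIFORMIZATION WITH MONOMIALIZATION of finitely many elements along one
zero-dimensional valuation on a `d`-dimensional regular germ — Zariski/Abhyankar's problem, printed for Abhyankar places with separable residue
field extension in every dimension (Knaf–Kuhlmann 2005 Thm. 1.1; typed `KnafKuhlmann2005_Thm11_monomialForm`, its discharge from the tree's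
PROVED Thm. 3.4 / Cor. 2.2 / Perron / Lemma 5.1 is in progress, seat decomp-res-hand-1 g3), for all valuations in dimension `≤ 3`
(Cossart–Piltant), and OPEN in dimension `≥ 4` exactly as «ELU in dimension 4» (Cutkosky–Mourtada 2019, Def. 1.2: "we do not know ELU in
dimension 4"; tree `Literature.AlgebraicGeometry.Resolution.ELUInDim`); it is implied by `hEmb_{d−1}` (the bottleneck
✓ `exists_localRing_monomial_of_embeddedResolution_gen`), so ✓ `cleanModels_dim_of_embeddedResolution` is the special case `hMono := ⟸ hEmb`.
Net reading of stub 7: `CleanModels(dim d) ⟸ LU-with-monomialization_d ∧ clean LU at defect valuations_d ∧ Piltant patching for P_clean_d` —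
the classical Zariski programme shape, each input typed; first open case `d = 4`.  Structural bookkeeping, counted 0.
-/

noncomputable section

set_option linter.dupNamespace false -- mandated namespace of this single-conjunct summit

open IsLocalRing AlgebraicGeometry CategoryTheory
open Literature.AlgebraicGeometry.Resolution Literature.AlgebraicGeometry.Motives

namespace Summit.ResolutionOfSingularities.ResolutionOfSingularities.Theorems.RadicialJung.CleanModels

/-! ## The joint, with the monomialization as a hypothesis -/

/-- **Clean local uniformization from a best `p`-th-power approximation and local monomialization of finite subsets of the model.**  Let `k`
have characteristic `p`, `K ⊇ k`, `O` a valuation ring of `K`, `A` a `k`-subalgebra of `K` with fraction field `K`, `g₀ ∉ K^p` with a best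
`p`-th-power approximation `f₀^p` for `v`, and suppose every finite `Z ⊆ A` is monomialized along `O` on some finitely generated `A ⊆ A' ⊆ O`
regular at the centre of `O` (`z = v ∏ aᵢ^{μᵢ}` for `z ∈ Z ∖ {0}`, `v` a unit, `(aᵢ)` a regular system of parameters).  Then the conclusion of the
line's dim-`d` local input holds: write `g₀ − f₀^p = x / y` with `x, y ∈ A`, monomialize `Z = {x, y}`, read off
(✓ `cleanLUConcl_of_isMin_pthPowerApprox_of_monomial_num_den`).  Any dimension, any valuation; ✓ `cleanLUAbh_of_knafKuhlmann` is the instance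
«`hMonoAt` := Knaf–Kuhlmann 2005 Thm. 1.1 at an Abhyankar place with separable residue field». [folklore] -/
theorem cleanLUConcl_of_isMin_pthPowerApprox_of_monomialization
    (p : ℕ) (hp : p.Prime) (k : Type) [Field k] [CharP k p] (K : Type) [Field K] [Algebra k K]
    (O : ValuationSubring K) (A : Subalgebra k K) (hfrac : IsFractionRing A K)
    (g₀ : K) (hg₀ : ∀ c : K, c ^ p ≠ g₀)
    (f₀ : K) (hmin : ∀ f : K, O.valuation (g₀ - f₀ ^ p) ≤ O.valuation (g₀ - f ^ p))
    (hMonoAt : ∀ Z : Finset K, (∀ z ∈ Z, z ∈ A) →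
      ∃ (A' : Subalgebra k K), A'.toSubring ≤ O.toSubring ∧ A ≤ A' ∧ A'.FG ∧
      ∃ (_ : IsRegularLocalRing (locAtCentre A'.toSubring O)) (e : ℕ) (a : Fin e → ↥(locAtCentre A'.toSubring O)),
        Ideal.span (Set.range a) = IsLocalRing.maximalIdeal ↥(locAtCentre A'.toSubring O) ∧
        ringKrullDim ↥(locAtCentre A'.toSubring O) = (e : WithBot ℕ∞) ∧
        ∀ z ∈ Z, z ≠ 0 → ∃ (v : ↥(locAtCentre A'.toSubring O)) (μ : Fin e → ℕ), IsUnit v ∧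
          z = (v : K) * ∏ i, ((a i : ↥(locAtCentre A'.toSubring O)) : K) ^ (μ i)) :
    ∃ (A' : Subalgebra k K), A'.toSubring ≤ O.toSubring ∧ A ≤ A' ∧ A'.FG ∧
      ∃ (_ : IsRegularLocalRing (locAtCentre A'.toSubring O)) (c : Fin p → K),
        (∃ j : Fin p, (j : ℕ) ≠ 0 ∧ c j ≠ 0) ∧
        ((∃ (d m : ℕ) (hmd : m ≤ d) (t : Fin d → ↥(locAtCentre A'.toSubring O)) (a : Fin m → ℕ)
            (u : ↥(locAtCentre A'.toSubring O)), IsUnit u ∧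
            Ideal.span (Set.range t) = IsLocalRing.maximalIdeal ↥(locAtCentre A'.toSubring O) ∧
            ringKrullDim ↥(locAtCentre A'.toSubring O) = (d : WithBot ℕ∞) ∧ 0 < m ∧ (∀ i, ¬ p ∣ a i) ∧
            (∑ j : Fin p, c j ^ p * g₀ ^ (j : ℕ)) =
              (u : K) * ∏ i : Fin m, ((t (Fin.castLE hmd i) : ↥(locAtCentre A'.toSubring O)) : K) ^ (a i)) ∨
          (∃ u : ↥(locAtCentre A'.toSubring O), IsUnit u ∧ (∑ j : Fin p, c j ^ p * g₀ ^ (j : ℕ)) = (u : K) ∧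
            ∀ c' : ↥(locAtCentre A'.toSubring O), u - c' ^ p ∉ IsLocalRing.maximalIdeal ↥(locAtCentre A'.toSubring O)) ∨
          (∃ s c' : ↥(locAtCentre A'.toSubring O), (∑ j : Fin p, c j ^ p * g₀ ^ (j : ℕ)) = (s : K) ∧
            s - c' ^ p ∈ IsLocalRing.maximalIdeal ↥(locAtCentre A'.toSubring O) ∧
            s - c' ^ p ∉ IsLocalRing.maximalIdeal ↥(locAtCentre A'.toSubring O) ^ 2)) := by
  classical
  -- the remainder as a fraction of elements of `A`
  obtain ⟨x, y, hy, hxy⟩ := IsFractionRing.div_surjective (A := A) (g₀ - f₀ ^ p)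
  have hxy' : g₀ - f₀ ^ p = (x : K) / (y : K) := hxy.symm
  -- monomialize `Z = {x, y}`
  let Z : Finset K := {(x : K), (y : K)}
  have hZA : ∀ z ∈ Z, z ∈ A := by
    intro z hz
    rcases Finset.mem_insert.mp hz with rfl | hz
    · exact x.2
    · rw [Finset.mem_singleton] at hz
      rw [hz]
      exact y.2
  obtain ⟨A', hA'O, hAA', hA'fg, hreg, d, a, hspan, hdim, hmono⟩ := hMonoAt Z hZA
  have hA'R : A'.toSubring ≤ locAtCentre A'.toSubring O := le_locAtCentre A'.toSubring O
  have hxZ : (x : K) ∈ Z := Finset.mem_insert_self _ _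
  have hyZ : (y : K) ∈ Z := Finset.mem_insert_of_mem (Finset.mem_singleton_self _)
  have hy0 : (y : K) ≠ 0 := fun h => (nonZeroDivisors.ne_zero hy) (Subtype.ext h)
  have hx0 : (x : K) ≠ 0 := by
    intro h
    apply hg₀ f₀
    have : g₀ - f₀ ^ p = 0 := by rw [hxy', h, zero_div]
    exact (sub_eq_zero.mp this).symm
  obtain ⟨u₁, β, hu₁, hx⟩ := hmono (x : K) hxZ hx0
  obtain ⟨u₂, γ, hu₂, hy'⟩ := hmono (y : K) hyZ hy0
  let x₂ : locAtCentre A'.toSubring O := ⟨x, hA'R (hAA' x.2)⟩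
  let y₂ : locAtCentre A'.toSubring O := ⟨y, hA'R (hAA' y.2)⟩
  have hx₂ : x₂ = u₁ * ∏ i, a i ^ β i := by
    apply Subtype.ext
    change (x : K) = _
    rw [hx]
    push_cast
    rfl
  have hy₂ : y₂ = u₂ * ∏ i, a i ^ γ i := by
    apply Subtype.ext
    change (y : K) = _
    rw [hy']
    push_cast
    rfl
  exact cleanLUConcl_of_isMin_pthPowerApprox_of_monomial_num_den p hp k K O A g₀ f₀ hmin A' hA'O hAA' hA'fg hreg a hspan
    hdim x₂ y₂ hxy' β γ u₁ u₂ hu₁ hu₂ hx₂ hy₂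

/-! ## The local inputs `hBest_d`, `hAbh_d` from local monomialization in dimension `d` -/

/-- **The input `hBest_d` of ✓ `cleanLUZeroDim_dim_of_cases` from local monomialization in dimension `d`** (hypothesis `hMono`: for every
finitely generated affine model `A ⊆ O` of a function field `K/k`, of dimension `≤ d`, regular of dimension `d` at the centre of a valuation
ring `O` all of whose centres above `A` are closed points, every finite `Z ⊆ A` is monomialized along `O` on a finitely generated refinement
`A ⊆ A' ⊆ O` regular at the centre).  Immediate from `cleanLUConcl_of_isMin_pthPowerApprox_of_monomialization`. [folklore] -/
theorem hBest_dim_of_localMonomialization (d : ℕ)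
    (hMono : ∀ (k : Type) [Field k] (K : Type) [Field K] [Algebra k K]
    (O : ValuationSubring K) (A : Subalgebra k K), A.toSubring ≤ O.toSubring → A.FG → IsFractionRing A K →
    ringKrullDim A ≤ (d : WithBot ℕ∞) → IsRegularLocalRing (locAtCentre A.toSubring O) →
    ringKrullDim (locAtCentre A.toSubring O) = (d : WithBot ℕ∞) →
    (∀ (T : Subring K) (hT : T ≤ O.toSubring), A.toSubring ≤ T → (subringCentre T O hT).IsMaximal) →
    ∀ Z : Finset K, (∀ z ∈ Z, z ∈ A) →
    ∃ (A' : Subalgebra k K), A'.toSubring ≤ O.toSubring ∧ A ≤ A' ∧ A'.FG ∧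
    ∃ (_ : IsRegularLocalRing (locAtCentre A'.toSubring O)) (e : ℕ) (a : Fin e → ↥(locAtCentre A'.toSubring O)),
      Ideal.span (Set.range a) = IsLocalRing.maximalIdeal ↥(locAtCentre A'.toSubring O) ∧
      ringKrullDim ↥(locAtCentre A'.toSubring O) = (e : WithBot ℕ∞) ∧
      ∀ z ∈ Z, z ≠ 0 → ∃ (v : ↥(locAtCentre A'.toSubring O)) (μ : Fin e → ℕ), IsUnit v ∧
        z = (v : K) * ∏ i, ((a i : ↥(locAtCentre A'.toSubring O)) : K) ^ (μ i)) :
    ∀ (p : ℕ), p.Prime →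
    ∀ (k : Type) [Field k] [CharP k p] (K : Type) [Field K] [Algebra k K]
    (O : ValuationSubring K) (A : Subalgebra k K), A.toSubring ≤ O.toSubring → A.FG → IsFractionRing A K →
    ringKrullDim A ≤ (d : WithBot ℕ∞) → IsRegularLocalRing (locAtCentre A.toSubring O) →
    ringKrullDim (locAtCentre A.toSubring O) = (d : WithBot ℕ∞) →
    (∀ (T : Subring K) (hT : T ≤ O.toSubring), A.toSubring ≤ T → (subringCentre T O hT).IsMaximal) →
    ∀ g₀ : K, (∀ c : K, c ^ p ≠ g₀) →
    ∀ f₀ : K, (∀ f : K, O.valuation (g₀ - f₀ ^ p) ≤ O.valuation (g₀ - f ^ p)) →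
    ∃ (A' : Subalgebra k K), A'.toSubring ≤ O.toSubring ∧ A ≤ A' ∧ A'.FG ∧
    ∃ (_ : IsRegularLocalRing (locAtCentre A'.toSubring O)) (c : Fin p → K), (∃ j : Fin p, (j : ℕ) ≠ 0 ∧ c j ≠ 0) ∧
    ((∃ (d m : ℕ) (hmd : m ≤ d) (t : Fin d → ↥(locAtCentre A'.toSubring O)) (a : Fin m → ℕ) (u : ↥(locAtCentre A'.toSubring O)), IsUnit u ∧
    Ideal.span (Set.range t) = IsLocalRing.maximalIdeal ↥(locAtCentre A'.toSubring O) ∧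
    ringKrullDim ↥(locAtCentre A'.toSubring O) = (d : WithBot ℕ∞) ∧ 0 < m ∧ (∀ i, ¬ p ∣ a i) ∧
    (∑ j : Fin p, c j ^ p * g₀ ^ (j : ℕ)) = (u : K) * ∏ i : Fin m, ((t (Fin.castLE hmd i) : ↥(locAtCentre A'.toSubring O)) : K) ^ (a i)) ∨
    (∃ u : ↥(locAtCentre A'.toSubring O), IsUnit u ∧ (∑ j : Fin p, c j ^ p * g₀ ^ (j : ℕ)) = (u : K) ∧
    ∀ c' : ↥(locAtCentre A'.toSubring O), u - c' ^ p ∉ IsLocalRing.maximalIdeal ↥(locAtCentre A'.toSubring O)) ∨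
    (∃ s c' : ↥(locAtCentre A'.toSubring O), (∑ j : Fin p, c j ^ p * g₀ ^ (j : ℕ)) = (s : K) ∧
    s - c' ^ p ∈ IsLocalRing.maximalIdeal ↥(locAtCentre A'.toSubring O) ∧
    s - c' ^ p ∉ IsLocalRing.maximalIdeal ↥(locAtCentre A'.toSubring O) ^ 2)) := by
  intro p hp k _ _ K _ _ O A hAO hAfg hfrac hdimA hreg hdim hzd g₀ hg₀ f₀ hf₀
  exact cleanLUConcl_of_isMin_pthPowerApprox_of_monomialization p hp k K O A hfrac g₀ hg₀ f₀ hf₀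
    (hMono k K O A hAO hAfg hfrac hdimA hreg hdim hzd)

/-- **The input `hAbh_d` of ✓ `cleanLUZeroDim_dim_of_cases` from local monomialization in dimension `d`**, every ground field: at an
ABHYANKAR valuation (transcendence defect `0`) of the function field `K/k`, `(K, O)` is a defectless field by Kuhlmann's generalized stability
theorem (✓ `Kuhlmann2010Stability_holds`), so `g₀` admits a best `p`-th-power approximation (✓ `exists_isMin_pthPowerApprox_of_isDefectlessField`)
and `cleanLUConcl_of_isMin_pthPowerApprox_of_monomialization` applies. [cite: Kuhlmann2010, Thm. 1.1] -/
theorem hAbh_dim_of_localMonomialization (d : ℕ)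
    (hMono : ∀ (k : Type) [Field k] (K : Type) [Field K] [Algebra k K]
    (O : ValuationSubring K) (A : Subalgebra k K), A.toSubring ≤ O.toSubring → A.FG → IsFractionRing A K →
    ringKrullDim A ≤ (d : WithBot ℕ∞) → IsRegularLocalRing (locAtCentre A.toSubring O) →
    ringKrullDim (locAtCentre A.toSubring O) = (d : WithBot ℕ∞) →
    (∀ (T : Subring K) (hT : T ≤ O.toSubring), A.toSubring ≤ T → (subringCentre T O hT).IsMaximal) →
    ∀ Z : Finset K, (∀ z ∈ Z, z ∈ A) →
    ∃ (A' : Subalgebra k K), A'.toSubring ≤ O.toSubring ∧ A ≤ A' ∧ A'.FG ∧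
    ∃ (_ : IsRegularLocalRing (locAtCentre A'.toSubring O)) (e : ℕ) (a : Fin e → ↥(locAtCentre A'.toSubring O)),
      Ideal.span (Set.range a) = IsLocalRing.maximalIdeal ↥(locAtCentre A'.toSubring O) ∧
      ringKrullDim ↥(locAtCentre A'.toSubring O) = (e : WithBot ℕ∞) ∧
      ∀ z ∈ Z, z ≠ 0 → ∃ (v : ↥(locAtCentre A'.toSubring O)) (μ : Fin e → ℕ), IsUnit v ∧
        z = (v : K) * ∏ i, ((a i : ↥(locAtCentre A'.toSubring O)) : K) ^ (μ i)) :
    ∀ (p : ℕ), p.Prime →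
    ∀ (k : Type) [Field k] [CharP k p] (K : Type) [Field K] [Algebra k K]
    (O : ValuationSubring K) (A : Subalgebra k K), A.toSubring ≤ O.toSubring → A.FG → IsFractionRing A K →
    ringKrullDim A ≤ (d : WithBot ℕ∞) → IsRegularLocalRing (locAtCentre A.toSubring O) →
    ringKrullDim (locAtCentre A.toSubring O) = (d : WithBot ℕ∞) →
    (∀ (T : Subring K) (hT : T ≤ O.toSubring), A.toSubring ≤ T → (subringCentre T O hT).IsMaximal) →
    ∀ g₀ : K, (∀ c : K, c ^ p ≠ g₀) →
    ∀ hk : ∀ c : k, algebraMap k K c ∈ O, transcendenceDefect k O hk = 0 →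
    ∃ (A' : Subalgebra k K), A'.toSubring ≤ O.toSubring ∧ A ≤ A' ∧ A'.FG ∧
    ∃ (_ : IsRegularLocalRing (locAtCentre A'.toSubring O)) (c : Fin p → K), (∃ j : Fin p, (j : ℕ) ≠ 0 ∧ c j ≠ 0) ∧
    ((∃ (d m : ℕ) (hmd : m ≤ d) (t : Fin d → ↥(locAtCentre A'.toSubring O)) (a : Fin m → ℕ) (u : ↥(locAtCentre A'.toSubring O)), IsUnit u ∧
    Ideal.span (Set.range t) = IsLocalRing.maximalIdeal ↥(locAtCentre A'.toSubring O) ∧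
    ringKrullDim ↥(locAtCentre A'.toSubring O) = (d : WithBot ℕ∞) ∧ 0 < m ∧ (∀ i, ¬ p ∣ a i) ∧
    (∑ j : Fin p, c j ^ p * g₀ ^ (j : ℕ)) = (u : K) * ∏ i : Fin m, ((t (Fin.castLE hmd i) : ↥(locAtCentre A'.toSubring O)) : K) ^ (a i)) ∨
    (∃ u : ↥(locAtCentre A'.toSubring O), IsUnit u ∧ (∑ j : Fin p, c j ^ p * g₀ ^ (j : ℕ)) = (u : K) ∧
    ∀ c' : ↥(locAtCentre A'.toSubring O), u - c' ^ p ∉ IsLocalRing.maximalIdeal ↥(locAtCentre A'.toSubring O)) ∨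
    (∃ s c' : ↥(locAtCentre A'.toSubring O), (∑ j : Fin p, c j ^ p * g₀ ^ (j : ℕ)) = (s : K) ∧
    s - c' ^ p ∈ IsLocalRing.maximalIdeal ↥(locAtCentre A'.toSubring O) ∧
    s - c' ^ p ∉ IsLocalRing.maximalIdeal ↥(locAtCentre A'.toSubring O) ^ 2)) := by
  intro p hp k _ _ K _ _ O A hAO hAfg hfrac hdimA hreg hdim hzd g₀ hg₀ hk htd
  haveI : Fact p.Prime := ⟨hp⟩
  haveI : CharP K p := charP_of_injective_algebraMap (algebraMap k K).injective p
  -- best `p`-th-power approximation (Kuhlmann's generalized stability theorem)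
  have hdef : IsDefectlessField K O := Kuhlmann2010Stability_holds k K (intermediateField_top_fg A hAfg hfrac) O hk htd
  obtain ⟨f₀, hf₀⟩ := exists_isMin_pthPowerApprox_of_isDefectlessField O hdef g₀ hg₀
  exact cleanLUConcl_of_isMin_pthPowerApprox_of_monomialization p hp k K O A hfrac g₀ hg₀ f₀ hf₀
    (hMono k K O A hAO hAfg hfrac hdimA hreg hdim hzd)

/-! ## Clean local uniformization at zero-dimensional valuations, dimension `d` -/

/-- **`CleanLUZeroDim_d` ⟸ local monomialization in dimension `d` ∧ the non-discrete defect residue in dimension `d`**: excluded middle on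
«best approximation exists» / «transcendence defect `0`» / «discrete of rank one» (✓ `cleanLUZeroDim_dim_of_cases`, hand-2 g0; the discrete
rank-one defect class is the LANDED arc theorem ✓ `Lens5ArcAllDim.cleanLUArcAtDim`, every `p`, `d`, `k`), the first two cases by
`hBest_dim_of_localMonomialization` / `hAbh_dim_of_localMonomialization`. [folklore] -/
theorem cleanLUZeroDim_dim_of_localMonomialization (d : ℕ)
    (hMono : ∀ (k : Type) [Field k] (K : Type) [Field K] [Algebra k K]
    (O : ValuationSubring K) (A : Subalgebra k K), A.toSubring ≤ O.toSubring → A.FG → IsFractionRing A K →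
    ringKrullDim A ≤ (d : WithBot ℕ∞) → IsRegularLocalRing (locAtCentre A.toSubring O) →
    ringKrullDim (locAtCentre A.toSubring O) = (d : WithBot ℕ∞) →
    (∀ (T : Subring K) (hT : T ≤ O.toSubring), A.toSubring ≤ T → (subringCentre T O hT).IsMaximal) →
    ∀ Z : Finset K, (∀ z ∈ Z, z ∈ A) →
    ∃ (A' : Subalgebra k K), A'.toSubring ≤ O.toSubring ∧ A ≤ A' ∧ A'.FG ∧
    ∃ (_ : IsRegularLocalRing (locAtCentre A'.toSubring O)) (e : ℕ) (a : Fin e → ↥(locAtCentre A'.toSubring O)),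
      Ideal.span (Set.range a) = IsLocalRing.maximalIdeal ↥(locAtCentre A'.toSubring O) ∧
      ringKrullDim ↥(locAtCentre A'.toSubring O) = (e : WithBot ℕ∞) ∧
      ∀ z ∈ Z, z ≠ 0 → ∃ (v : ↥(locAtCentre A'.toSubring O)) (μ : Fin e → ℕ), IsUnit v ∧
        z = (v : K) * ∏ i, ((a i : ↥(locAtCentre A'.toSubring O)) : K) ^ (μ i))
    (hND : ∀ (p : ℕ), p.Prime →
    ∀ (k : Type) [Field k] [CharP k p] (K : Type) [Field K] [Algebra k K]
    (O : ValuationSubring K) (A : Subalgebra k K), A.toSubring ≤ O.toSubring → A.FG → IsFractionRing A K →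
    ringKrullDim A ≤ (d : WithBot ℕ∞) → IsRegularLocalRing (locAtCentre A.toSubring O) →
    ringKrullDim (locAtCentre A.toSubring O) = (d : WithBot ℕ∞) →
    (∀ (T : Subring K) (hT : T ≤ O.toSubring), A.toSubring ≤ T → (subringCentre T O hT).IsMaximal) →
    ∀ g₀ : K, (∀ c : K, c ^ p ≠ g₀) →
    (∀ f₀ : K, ∃ f₁ : K, O.valuation (g₀ - f₁ ^ p) < O.valuation (g₀ - f₀ ^ p)) →
    (∀ hk : ∀ c : k, algebraMap k K c ∈ O, transcendenceDefect k O hk ≠ 0) →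
    ¬ (∃ π : K, π ≠ 0 ∧ (∀ x : K, O.valuation x < 1 → O.valuation x ≤ O.valuation π) ∧
      (∀ x : K, x ≠ 0 → ∃ n : ℕ, O.valuation π ^ n ≤ O.valuation x)) →
    ∃ (A' : Subalgebra k K), A'.toSubring ≤ O.toSubring ∧ A ≤ A' ∧ A'.FG ∧
    ∃ (_ : IsRegularLocalRing (locAtCentre A'.toSubring O)) (c : Fin p → K), (∃ j : Fin p, (j : ℕ) ≠ 0 ∧ c j ≠ 0) ∧
    ((∃ (d m : ℕ) (hmd : m ≤ d) (t : Fin d → ↥(locAtCentre A'.toSubring O)) (a : Fin m → ℕ) (u : ↥(locAtCentre A'.toSubring O)), IsUnit u ∧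
    Ideal.span (Set.range t) = IsLocalRing.maximalIdeal ↥(locAtCentre A'.toSubring O) ∧
    ringKrullDim ↥(locAtCentre A'.toSubring O) = (d : WithBot ℕ∞) ∧ 0 < m ∧ (∀ i, ¬ p ∣ a i) ∧
    (∑ j : Fin p, c j ^ p * g₀ ^ (j : ℕ)) = (u : K) * ∏ i : Fin m, ((t (Fin.castLE hmd i) : ↥(locAtCentre A'.toSubring O)) : K) ^ (a i)) ∨
    (∃ u : ↥(locAtCentre A'.toSubring O), IsUnit u ∧ (∑ j : Fin p, c j ^ p * g₀ ^ (j : ℕ)) = (u : K) ∧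
    ∀ c' : ↥(locAtCentre A'.toSubring O), u - c' ^ p ∉ IsLocalRing.maximalIdeal ↥(locAtCentre A'.toSubring O)) ∨
    (∃ s c' : ↥(locAtCentre A'.toSubring O), (∑ j : Fin p, c j ^ p * g₀ ^ (j : ℕ)) = (s : K) ∧
    s - c' ^ p ∈ IsLocalRing.maximalIdeal ↥(locAtCentre A'.toSubring O) ∧
    s - c' ^ p ∉ IsLocalRing.maximalIdeal ↥(locAtCentre A'.toSubring O) ^ 2))) :
    ∀ (p : ℕ), p.Prime →
    ∀ (k : Type) [Field k] [CharP k p] (K : Type) [Field K] [Algebra k K]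
    (O : ValuationSubring K) (A : Subalgebra k K), A.toSubring ≤ O.toSubring → A.FG → IsFractionRing A K →
    ringKrullDim A ≤ (d : WithBot ℕ∞) → IsRegularLocalRing (locAtCentre A.toSubring O) →
    ringKrullDim (locAtCentre A.toSubring O) = (d : WithBot ℕ∞) →
    (∀ (T : Subring K) (hT : T ≤ O.toSubring), A.toSubring ≤ T → (subringCentre T O hT).IsMaximal) →
    ∀ g₀ : K, (∀ c : K, c ^ p ≠ g₀) →
    ∃ (A' : Subalgebra k K), A'.toSubring ≤ O.toSubring ∧ A ≤ A' ∧ A'.FG ∧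
    ∃ (_ : IsRegularLocalRing (locAtCentre A'.toSubring O)) (c : Fin p → K), (∃ j : Fin p, (j : ℕ) ≠ 0 ∧ c j ≠ 0) ∧
    ((∃ (d m : ℕ) (hmd : m ≤ d) (t : Fin d → ↥(locAtCentre A'.toSubring O)) (a : Fin m → ℕ) (u : ↥(locAtCentre A'.toSubring O)), IsUnit u ∧
    Ideal.span (Set.range t) = IsLocalRing.maximalIdeal ↥(locAtCentre A'.toSubring O) ∧
    ringKrullDim ↥(locAtCentre A'.toSubring O) = (d : WithBot ℕ∞) ∧ 0 < m ∧ (∀ i, ¬ p ∣ a i) ∧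
    (∑ j : Fin p, c j ^ p * g₀ ^ (j : ℕ)) = (u : K) * ∏ i : Fin m, ((t (Fin.castLE hmd i) : ↥(locAtCentre A'.toSubring O)) : K) ^ (a i)) ∨
    (∃ u : ↥(locAtCentre A'.toSubring O), IsUnit u ∧ (∑ j : Fin p, c j ^ p * g₀ ^ (j : ℕ)) = (u : K) ∧
    ∀ c' : ↥(locAtCentre A'.toSubring O), u - c' ^ p ∉ IsLocalRing.maximalIdeal ↥(locAtCentre A'.toSubring O)) ∨
    (∃ s c' : ↥(locAtCentre A'.toSubring O), (∑ j : Fin p, c j ^ p * g₀ ^ (j : ℕ)) = (s : K) ∧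
    s - c' ^ p ∈ IsLocalRing.maximalIdeal ↥(locAtCentre A'.toSubring O) ∧
    s - c' ^ p ∉ IsLocalRing.maximalIdeal ↥(locAtCentre A'.toSubring O) ^ 2)) :=
  cleanLUZeroDim_dim_of_cases d (hBest_dim_of_localMonomialization d hMono) (hAbh_dim_of_localMonomialization d hMono) hND

/-! ## The crux in dimension `n + 1`, and the frontier stub for every `d ≥ 4` -/

/-- **`CleanModels` in dimension exactly `n + 1` from local monomialization, the non-discrete defect residue and two-model patching for
`P_clean`, all in dimension `n + 1`**: for `p` prime, `k` of characteristic `p`, `W` regular integral separated of finite type over `k` with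
`dim W = n + 1`, `L/K(W)` purely inseparable of degree `p`, there is a proper birational regular `V → W` on which, at every point, some
`y ∈ L ∖ K(W)` has `y^p = g ∈ K(W)` of toroidal or regular type — GIVEN `hMono_{n+1}` (local monomialization of finite subsets of the model along
zero-dimensional valuations with `(n+1)`-dimensional regular centre: local uniformization strength; printed at Abhyankar places with separable
residue field, Knaf–Kuhlmann 2005 Thm. 1.1; open in dimension `≥ 4`, Cutkosky–Mourtada 2019 Def. 1.2), `hND_{n+1}` (clean LU at the zero-dimensional
non-discrete defect non-Abhyankar valuations — the dim-`(n+1)` form of the line's class (B)) and `hZ_{n+1}` (Piltant's two-model patching for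
`P_clean` in transcendence degree `n + 1`).  Generalises ✓ `cleanModels_dim_of_embeddedResolution` (whose `hEmb_n` implies `hMono_{n+1}` through
✓ `exists_localRing_monomial_of_embeddedResolution_gen`).  All three inputs OPEN for `n ≥ 3`; structural reduction only.
[cite: KnafKuhlmann2005, Thm. 1.1] [cite: CutkoskyMourtada2019, Def. 1.2] [cite: Piltant2013, Cor. 5.7 and p. 2] [cite: Kuhlmann2010, Thm. 1.1] -/
theorem cleanModels_dim_of_localMonomialization (n : ℕ)
    (hMono : ∀ (k : Type) [Field k] (K : Type) [Field K] [Algebra k K]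
    (O : ValuationSubring K) (A : Subalgebra k K), A.toSubring ≤ O.toSubring → A.FG → IsFractionRing A K →
    ringKrullDim A ≤ ((n + 1 : ℕ) : WithBot ℕ∞) → IsRegularLocalRing (locAtCentre A.toSubring O) →
    ringKrullDim (locAtCentre A.toSubring O) = ((n + 1 : ℕ) : WithBot ℕ∞) →
    (∀ (T : Subring K) (hT : T ≤ O.toSubring), A.toSubring ≤ T → (subringCentre T O hT).IsMaximal) →
    ∀ Z : Finset K, (∀ z ∈ Z, z ∈ A) →
    ∃ (A' : Subalgebra k K), A'.toSubring ≤ O.toSubring ∧ A ≤ A' ∧ A'.FG ∧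
    ∃ (_ : IsRegularLocalRing (locAtCentre A'.toSubring O)) (e : ℕ) (a : Fin e → ↥(locAtCentre A'.toSubring O)),
      Ideal.span (Set.range a) = IsLocalRing.maximalIdeal ↥(locAtCentre A'.toSubring O) ∧
      ringKrullDim ↥(locAtCentre A'.toSubring O) = (e : WithBot ℕ∞) ∧
      ∀ z ∈ Z, z ≠ 0 → ∃ (v : ↥(locAtCentre A'.toSubring O)) (μ : Fin e → ℕ), IsUnit v ∧
        z = (v : K) * ∏ i, ((a i : ↥(locAtCentre A'.toSubring O)) : K) ^ (μ i))
    (hND : ∀ (p : ℕ), p.Prime →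
    ∀ (k : Type) [Field k] [CharP k p] (K : Type) [Field K] [Algebra k K]
    (O : ValuationSubring K) (A : Subalgebra k K), A.toSubring ≤ O.toSubring → A.FG → IsFractionRing A K →
    ringKrullDim A ≤ ((n + 1 : ℕ) : WithBot ℕ∞) → IsRegularLocalRing (locAtCentre A.toSubring O) →
    ringKrullDim (locAtCentre A.toSubring O) = ((n + 1 : ℕ) : WithBot ℕ∞) →
    (∀ (T : Subring K) (hT : T ≤ O.toSubring), A.toSubring ≤ T → (subringCentre T O hT).IsMaximal) →
    ∀ g₀ : K, (∀ c : K, c ^ p ≠ g₀) →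
    (∀ f₀ : K, ∃ f₁ : K, O.valuation (g₀ - f₁ ^ p) < O.valuation (g₀ - f₀ ^ p)) →
    (∀ hk : ∀ c : k, algebraMap k K c ∈ O, transcendenceDefect k O hk ≠ 0) →
    ¬ (∃ π : K, π ≠ 0 ∧ (∀ x : K, O.valuation x < 1 → O.valuation x ≤ O.valuation π) ∧
      (∀ x : K, x ≠ 0 → ∃ n : ℕ, O.valuation π ^ n ≤ O.valuation x)) →
    ∃ (A' : Subalgebra k K), A'.toSubring ≤ O.toSubring ∧ A ≤ A' ∧ A'.FG ∧
    ∃ (_ : IsRegularLocalRing (locAtCentre A'.toSubring O)) (c : Fin p → K), (∃ j : Fin p, (j : ℕ) ≠ 0 ∧ c j ≠ 0) ∧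
    ((∃ (d m : ℕ) (hmd : m ≤ d) (t : Fin d → ↥(locAtCentre A'.toSubring O)) (a : Fin m → ℕ) (u : ↥(locAtCentre A'.toSubring O)), IsUnit u ∧
    Ideal.span (Set.range t) = IsLocalRing.maximalIdeal ↥(locAtCentre A'.toSubring O) ∧
    ringKrullDim ↥(locAtCentre A'.toSubring O) = (d : WithBot ℕ∞) ∧ 0 < m ∧ (∀ i, ¬ p ∣ a i) ∧
    (∑ j : Fin p, c j ^ p * g₀ ^ (j : ℕ)) = (u : K) * ∏ i : Fin m, ((t (Fin.castLE hmd i) : ↥(locAtCentre A'.toSubring O)) : K) ^ (a i)) ∨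
    (∃ u : ↥(locAtCentre A'.toSubring O), IsUnit u ∧ (∑ j : Fin p, c j ^ p * g₀ ^ (j : ℕ)) = (u : K) ∧
    ∀ c' : ↥(locAtCentre A'.toSubring O), u - c' ^ p ∉ IsLocalRing.maximalIdeal ↥(locAtCentre A'.toSubring O)) ∨
    (∃ s c' : ↥(locAtCentre A'.toSubring O), (∑ j : Fin p, c j ^ p * g₀ ^ (j : ℕ)) = (s : K) ∧
    s - c' ^ p ∈ IsLocalRing.maximalIdeal ↥(locAtCentre A'.toSubring O) ∧
    s - c' ^ p ∉ IsLocalRing.maximalIdeal ↥(locAtCentre A'.toSubring O) ^ 2)))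
    (hZ : ∀ (p : ℕ), p.Prime → ∀ (k K : Type) [Field k] [CharP k p] [Field K] [Algebra k K] [Algebra.EssFiniteType k K],
    Algebra.trdeg k K = (n + 1 : ℕ) → ∀ (g₀ : K) (M₁ M₂ : ProjModel k K) (U₁ : M₁.X.Opens) (U₂ : M₂.X.Opens),
    (∀ x ∈ U₁, ModelCleanRegAt p g₀ M₁ x) → (∀ x ∈ U₂, ModelCleanRegAt p g₀ M₂ x) →
    ∃ (N : ProjModel k K) (φ₁ : N.Hom M₁) (φ₂ : N.Hom M₂),
    (∀ y : N.X, φ₁.f y ∈ U₁ → ModelCleanRegAt p g₀ N y) ∧ (∀ y : N.X, φ₂.f y ∈ U₂ → ModelCleanRegAt p g₀ N y)) :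
    ∀ p : ℕ, p.Prime → ∀ (k : Type) [Field k] [CharP k p] (W : AlgebraicGeometry.Scheme.{0}) [AlgebraicGeometry.IsIntegral W] (f : W ⟶ AlgebraicGeometry.Spec (.of k)) (L : Type) [Field L] [Algebra W.functionField L], AlgebraicGeometry.IsSeparated f → AlgebraicGeometry.LocallyOfFiniteType f → AlgebraicGeometry.QuasiCompact f → Literature.AlgebraicGeometry.Resolution.Scheme.IsRegular W → IsPurelyInseparable W.functionField L → Module.finrank W.functionField L = p → topologicalKrullDim W = ((n + 1 : ℕ) : WithBot ℕ∞) → ∃ (V : AlgebraicGeometry.Scheme.{0}) (π : V ⟶ W) (_ : AlgebraicGeometry.IsIntegral V) (_ : AlgebraicGeometry.IsDominant π), AlgebraicGeometry.IsProper π ∧ Literature.AlgebraicGeometry.Resolution.IsBirational π ∧ Literature.AlgebraicGeometry.Resolution.Scheme.IsRegular V ∧ (∀ v : V, (∃ (y : L) (g : W.functionField), y ∉ Set.range (algebraMap W.functionField L) ∧ algebraMap W.functionField L g = y ^ p ∧ ((∃ (d m : ℕ) (hmd : m ≤ d) (t : Fin d → V.presheaf.stalk v) (a : Fin m → ℕ),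 Ideal.span (Set.range t) = IsLocalRing.maximalIdeal (V.presheaf.stalk v) ∧ ringKrullDim (V.presheaf.stalk v) = (d : WithBot ℕ∞) ∧ 0 < m ∧ (∀ i, ¬ p ∣ a i) ∧ Literature.AlgebraicGeometry.Motives.RatFn.functionFieldMap π g = ∏ i : Fin m, (algebraMap (V.presheaf.stalk v) V.functionField (t (Fin.castLE hmd i))) ^ (a i)) ∨ (∃ u₀ : V.presheaf.stalk v, IsUnit u₀ ∧ Literature.AlgebraicGeometry.Motives.RatFn.functionFieldMap π g = algebraMap (V.presheaf.stalk v) V.functionField u₀ ∧ ((∀ c : V.presheaf.stalk v, u₀ - c ^ p ∉ IsLocalRing.maximalIdeal (V.presheaf.stalk v)) ∨ (∃ c : V.presheaf.stalk v, u₀ - c ^ p ∈ IsLocalRing.maximalIdeal (V.presheaf.stalk v) ∧ u₀ - c ^ p ∉ IsLocalRing.maximalIdeal (V.presheaf.stalk v) ^ 2)))))) := by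
  intro p hp k _ _ W _ f L _ _ hsep hloc hqc hWreg hPI hdeg hdW
  haveI := hsep; haveI := hloc; haveI := hqc
  refine cleanModelsAt_of_logCleanPrincipalizationAt p hp k W f L hPI hdeg fun g₀ hg₀ => ?_
  exact cleanGlobalization_dim (d := n + 1)
    (cleanCharts_dim_of_cleanLUZeroDim_dim (cleanLUZeroDim_dim_of_localMonomialization (n + 1) hMono hND)) hZ p hp k W f
    hWreg hdW g₀ hg₀

/-- **The frontier stub `stub_cleanModelsDimGEFour` (statement VERBATIM) from local monomialization, the non-discrete defect residue and
two-model patching for `P_clean`, each asked in every dimension `d ≥ 4`** — composition of hand-2 g0's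
✓ `cleanModelsDimGEFour_of_localCases_of_cleanTwoModelPatching` with `hBest_dim_of_localMonomialization` / `hAbh_dim_of_localMonomialization`.
The three inputs are OPEN in dimension `≥ 4`; the arc class and all the glue are PROVED.  Structural reduction only.
[cite: KnafKuhlmann2005, Thm. 1.1] [cite: CutkoskyMourtada2019, Def. 1.2] [cite: Piltant2013, Cor. 5.7 and p. 2] -/
theorem cleanModelsDimGEFour_of_localMonomialization
    (hMono : ∀ d : ℕ, 4 ≤ d → ∀ (k : Type) [Field k] (K : Type) [Field K] [Algebra k K]
    (O : ValuationSubring K) (A : Subalgebra k K), A.toSubring ≤ O.toSubring → A.FG → IsFractionRing A K →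
    ringKrullDim A ≤ (d : WithBot ℕ∞) → IsRegularLocalRing (locAtCentre A.toSubring O) →
    ringKrullDim (locAtCentre A.toSubring O) = (d : WithBot ℕ∞) →
    (∀ (T : Subring K) (hT : T ≤ O.toSubring), A.toSubring ≤ T → (subringCentre T O hT).IsMaximal) →
    ∀ Z : Finset K, (∀ z ∈ Z, z ∈ A) →
    ∃ (A' : Subalgebra k K), A'.toSubring ≤ O.toSubring ∧ A ≤ A' ∧ A'.FG ∧
    ∃ (_ : IsRegularLocalRing (locAtCentre A'.toSubring O)) (e : ℕ) (a : Fin e → ↥(locAtCentre A'.toSubring O)),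
      Ideal.span (Set.range a) = IsLocalRing.maximalIdeal ↥(locAtCentre A'.toSubring O) ∧
      ringKrullDim ↥(locAtCentre A'.toSubring O) = (e : WithBot ℕ∞) ∧
      ∀ z ∈ Z, z ≠ 0 → ∃ (v : ↥(locAtCentre A'.toSubring O)) (μ : Fin e → ℕ), IsUnit v ∧
        z = (v : K) * ∏ i, ((a i : ↥(locAtCentre A'.toSubring O)) : K) ^ (μ i))
    (hND : ∀ d : ℕ, 4 ≤ d → ∀ (p : ℕ), p.Prime →
    ∀ (k : Type) [Field k] [CharP k p] (K : Type) [Field K] [Algebra k K]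
    (O : ValuationSubring K) (A : Subalgebra k K), A.toSubring ≤ O.toSubring → A.FG → IsFractionRing A K →
    ringKrullDim A ≤ (d : WithBot ℕ∞) → IsRegularLocalRing (locAtCentre A.toSubring O) →
    ringKrullDim (locAtCentre A.toSubring O) = (d : WithBot ℕ∞) →
    (∀ (T : Subring K) (hT : T ≤ O.toSubring), A.toSubring ≤ T → (subringCentre T O hT).IsMaximal) →
    ∀ g₀ : K, (∀ c : K, c ^ p ≠ g₀) →
    (∀ f₀ : K, ∃ f₁ : K, O.valuation (g₀ - f₁ ^ p) < O.valuation (g₀ - f₀ ^ p)) →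
    (∀ hk : ∀ c : k, algebraMap k K c ∈ O, transcendenceDefect k O hk ≠ 0) →
    ¬ (∃ π : K, π ≠ 0 ∧ (∀ x : K, O.valuation x < 1 → O.valuation x ≤ O.valuation π) ∧
      (∀ x : K, x ≠ 0 → ∃ n : ℕ, O.valuation π ^ n ≤ O.valuation x)) →
    ∃ (A' : Subalgebra k K), A'.toSubring ≤ O.toSubring ∧ A ≤ A' ∧ A'.FG ∧
    ∃ (_ : IsRegularLocalRing (locAtCentre A'.toSubring O)) (c : Fin p → K), (∃ j : Fin p, (j : ℕ) ≠ 0 ∧ c j ≠ 0) ∧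
    ((∃ (d m : ℕ) (hmd : m ≤ d) (t : Fin d → ↥(locAtCentre A'.toSubring O)) (a : Fin m → ℕ) (u : ↥(locAtCentre A'.toSubring O)), IsUnit u ∧
    Ideal.span (Set.range t) = IsLocalRing.maximalIdeal ↥(locAtCentre A'.toSubring O) ∧
    ringKrullDim ↥(locAtCentre A'.toSubring O) = (d : WithBot ℕ∞) ∧ 0 < m ∧ (∀ i, ¬ p ∣ a i) ∧
    (∑ j : Fin p, c j ^ p * g₀ ^ (j : ℕ)) = (u : K) * ∏ i : Fin m, ((t (Fin.castLE hmd i) : ↥(locAtCentre A'.toSubring O)) : K) ^ (a i)) ∨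
    (∃ u : ↥(locAtCentre A'.toSubring O), IsUnit u ∧ (∑ j : Fin p, c j ^ p * g₀ ^ (j : ℕ)) = (u : K) ∧
    ∀ c' : ↥(locAtCentre A'.toSubring O), u - c' ^ p ∉ IsLocalRing.maximalIdeal ↥(locAtCentre A'.toSubring O)) ∨
    (∃ s c' : ↥(locAtCentre A'.toSubring O), (∑ j : Fin p, c j ^ p * g₀ ^ (j : ℕ)) = (s : K) ∧
    s - c' ^ p ∈ IsLocalRing.maximalIdeal ↥(locAtCentre A'.toSubring O) ∧
    s - c' ^ p ∉ IsLocalRing.maximalIdeal ↥(locAtCentre A'.toSubring O) ^ 2)))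
    (hZ : ∀ d : ℕ, 4 ≤ d → ∀ (p : ℕ), p.Prime → ∀ (k K : Type) [Field k] [CharP k p] [Field K] [Algebra k K]
    [Algebra.EssFiniteType k K],
    Algebra.trdeg k K = d → ∀ (g₀ : K) (M₁ M₂ : ProjModel k K) (U₁ : M₁.X.Opens) (U₂ : M₂.X.Opens),
    (∀ x ∈ U₁, ModelCleanRegAt p g₀ M₁ x) → (∀ x ∈ U₂, ModelCleanRegAt p g₀ M₂ x) →
    ∃ (N : ProjModel k K) (φ₁ : N.Hom M₁) (φ₂ : N.Hom M₂),
    (∀ y : N.X, φ₁.f y ∈ U₁ → ModelCleanRegAt p g₀ N y) ∧ (∀ y : N.X, φ₂.f y ∈ U₂ → ModelCleanRegAt p g₀ N y)) :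
    ∀ p : ℕ, p.Prime → ∀ (k : Type) [Field k] [CharP k p] (W : AlgebraicGeometry.Scheme.{0}) [AlgebraicGeometry.IsIntegral W] (f : W ⟶ AlgebraicGeometry.Spec (.of k)) (L : Type) [Field L] [Algebra W.functionField L], AlgebraicGeometry.IsSeparated f → AlgebraicGeometry.LocallyOfFiniteType f → AlgebraicGeometry.QuasiCompact f → Literature.AlgebraicGeometry.Resolution.Scheme.IsRegular W → IsPurelyInseparable W.functionField L → Module.finrank W.functionField L = p → ¬ topologicalKrullDim W ≤ 3 → ∃ (V : AlgebraicGeometry.Scheme.{0}) (π : V ⟶ W) (_ : AlgebraicGeometry.IsIntegral V) (_ : AlgebraicGeometry.IsDominant π), AlgebraicGeometry.IsProper π ∧ Literature.AlgebraicGeometry.Resolution.IsBirational π ∧ Literature.AlgebraicGeometry.Resolution.Scheme.IsRegular V ∧ (∀ v : V, (∃ (y : L) (g : W.functionField), y ∉ Set.range (algebraMap W.functionField L) ∧ algebraMap W.functionField L g = y ^ p ∧ ((∃ (d m : ℕ) (hmd : m ≤ d) (t : Fin d → V.presheaf.stalk v) (a : Fin m → ℕ), Ideal.span (Set.range t) =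 IsLocalRing.maximalIdeal (V.presheaf.stalk v) ∧ ringKrullDim (V.presheaf.stalk v) = (d : WithBot ℕ∞) ∧ 0 < m ∧ (∀ i, ¬ p ∣ a i) ∧ Literature.AlgebraicGeometry.Motives.RatFn.functionFieldMap π g = ∏ i : Fin m, (algebraMap (V.presheaf.stalk v) V.functionField (t (Fin.castLE hmd i))) ^ (a i)) ∨ (∃ u₀ : V.presheaf.stalk v, IsUnit u₀ ∧ Literature.AlgebraicGeometry.Motives.RatFn.functionFieldMap π g = algebraMap (V.presheaf.stalk v) V.functionField u₀ ∧ ((∀ c : V.presheaf.stalk v, u₀ - c ^ p ∉ IsLocalRing.maximalIdeal (V.presheaf.stalk v)) ∨ (∃ c : V.presheaf.stalk v, u₀ - c ^ p ∈ IsLocalRing.maximalIdeal (V.presheaf.stalk v) ∧ u₀ - c ^ p ∉ IsLocalRing.maximalIdeal (V.presheaf.stalk v) ^ 2)))))) :=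
  cleanModelsDimGEFour_of_localCases_of_cleanTwoModelPatching
    (fun d hd => hBest_dim_of_localMonomialization d (hMono d hd))
    (fun d hd => hAbh_dim_of_localMonomialization d (hMono d hd)) hND hZ

end Summit.ResolutionOfSingularities.ResolutionOfSingularities.Theorems.RadicialJung.CleanModels

end
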